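import Literature.AnabelianGeometry.EtaleTheta.LogDivisorModelTateTowerThetaGalois
import Literature.AnabelianGeometry.EtaleTheta.DivisorMonoidsOfGaloisCoveringConnected

/-!
# [EtTh] Def. 3.3 (iii) / Rmk. 3.3.1 at the `Ÿ`-skeleton with cusps: coordinates of `Φ₀(S)`, the diagonal, the constants
# `F₀(S)` and their divisors, coprimality — and `rank Φ₀(S) ≥ 2` at EVERY covering (Tate tower v3, piece 1c — class (b) NV)

S. Mochizuki, *The étale theta function …*, Publ. RIMS **45** (2009) [MochizukiEtTh2009], Def. 3.1 (i) p.70 (`DIV⁺ ≅ ∏ ℤ_{≥0}` over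
cusps ⊔ components), Def. 3.3 (iii) / Rmk. 3.3.1 p.73, Prop. 3.4 (ii) p.74, Def. 3.6 (ii)(a) p.77 (`Φ^{bs-fld} = Φ ∩ ℝ·Φ₀^cnst`),
Def. 4.1 (i) p.86 («disjoint supports»), Prop. 1.4 (i) p.21 [cite: MochizukiEtTh2009, Def 3.3 p.73].

CLASS (b) MODEL / NON-VACUITY WITNESS (abc-iut cell, layer L2; seat abc-iut-L2-t3 (gen 7), row «TATE TOWER v3, PIECE 1» of
abc-iut-L2-lead R767, third file).  Consumed BY NAME: pieces 1a/1b (`TateTowerTheta.model`, `action φ`, `thetaZerosPhi`,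
`actFn_of_mem_const`), `GaloisAction.phiZero/bZero/fZero/divAt/divZeroHom` (abc-iut-w6-d058), `isConnectedGSet`.  The analogue, for
the skeleton WITH cusps, of abc-iut-w5-d179's `LogDivisorModelZTower` §2 — the coordinate calculus every tempered-Frobenioid
engine over these data starts from:
* `mlt`, `coord φ S s x : Φ₀(S) →* ℤ_{≥0}` for EVERY prime log-divisor `x ∈ Cusp ⊔ Comp` (jointly injective, `coord_separating`;
  equivariance `coord (g·s) x = coord s ((shift (φ g))⁻¹ x)`, `coord_ρ`);
* the DIAGONAL `diag φ S ∈ Φ₀(S)` (`= div ϖ̈ = Σ_j [F_j]`: coordinate `1` on the components, `0` at the cusps) and the CUSPIDAL element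
  `thetaZerosPhi φ S` (piece 1b; coordinate `0` on the components, `1` at the cusps): neither is a root of a power of the other
  (`thetaZerosPhi_pow_ne_diag_pow`), so **`Φ₀(S)` has rank `≥ 2` at EVERY nonempty covering `S`** — in particular at the
  one-point covering `Γ/Γ`, where the chain-only skeletons (`TateTower`, `ZTower`) are rank ONE (`Φ₀ ≅ ℤ_{≥0}`): Def. 3.6 (ii)(a)
  «`Φ^{bs-fld} ⊊ Φ`» acquires content from the CUSPS, not from the components;
* the CONSTANTS: `cnstFn φ S u` (`u ∈ μ₂ × ⟨ϖ̈⟩`), `div₀(cnstFn u) = [diag]^{eC u}` (`divZeroHom_cnstFn`), and on a CONNECTED `S` every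
  element of `F₀(S)` is some `cnstFn u` (`exists_eq_cnstFn_of_mem_fZero`) — so `Φ₀^cnst(S) = ⟨[diag]⟩` exactly as for the chain
  (`divZeroHom_mem_zpowers_of_mem_fZero`): the cusps never meet `ℝ·Φ₀^cnst`;
* divisibility and coprimality through the coordinates (`dvd_iff_coord_le`, the pointwise minimum `exists_inf`,
  `coprime_iff_coord` — «no common non-trivial divisor ⟺ disjoint coordinate supports», Def. 4.1 (i)).
HONEST FRAMING: a combinatorial consistency witness (NOT the formal scheme `Ÿ`); defs + theorems only, no Prop-valued fact, no
instance, no notation, no sorry; nothing here bears on [IUTchIII] Cor. 3.12; no side taken; typed ≠ proved.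
-/

noncomputable section

namespace Literature.AnabelianGeometry.EtaleTheta

open CategoryTheory

namespace LogDivisorModel

namespace TateTowerTheta

open GaloisAction

/-! ## Multiplicities -/

/-- The multiplicity of a log-divisor of `Ÿ` at the prime log-divisor `x ∈ Cusp ⊔ Comp`. [cite: MochizukiEtTh2009, Def 3.1 p.70] -/
def mlt (d : model.DIV) (x : Idx) : ℤ := Multiplicative.toAdd (α := Idx → ℤ) d x

/-- Multiplicities are additive. [cite: MochizukiEtTh2009, Def 3.1 p.70] -/
theorem mlt_mul (a b : model.DIV) (x : Idx) : mlt (a * b) x = mlt a x + mlt b x := rfl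

/-- The trivial log-divisor has no multiplicity. [cite: MochizukiEtTh2009, Def 3.1 p.70] -/
theorem mlt_one (x : Idx) : mlt 1 x = 0 := rfl

/-- Multiplicities of powers. [cite: MochizukiEtTh2009, Def 3.1 p.70] -/
theorem mlt_pow (d : model.DIV) (n : ℕ) (x : Idx) : mlt (d ^ n) x = n * mlt d x := by
  induction n with
  | zero => rw [pow_zero, mlt_one, Nat.cast_zero, zero_mul]
  | succ n ih => rw [pow_succ, mlt_mul, ih, Nat.cast_succ]; ring

/-- A log-divisor is determined by its multiplicities. [cite: MochizukiEtTh2009, Def 3.1 p.70] -/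
theorem ext_mlt {a b : model.DIV} (h : ∀ x, mlt a x = mlt b x) : a = b :=
  (Multiplicative.toAdd (α := Idx → ℤ)).injective (funext h)

/-- Effective Cartier = non-negative multiplicities (every log-divisor of the skeleton is Cartier).
[cite: MochizukiEtTh2009, Def 3.1 p.70] -/
theorem mem_Divplus_iff (d : model.DIV) : d ∈ model.Divplus ↔ ∀ x, 0 ≤ mlt d x :=
  ⟨fun h x => h.2 x, fun h => ⟨trivial, h⟩⟩

variable {Γ : Type} [Group Γ] (φ : Γ →* Multiplicative ℤ)

/-- The action on log-divisors is the translation by `φ g`: `mlt (g·d) x = mlt d ((shift (φ g))⁻¹ x)`.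
[cite: MochizukiEtTh2009, Def 3.3 p.73] -/
theorem mlt_actDIV (g : Γ) (d : model.DIV) (x : Idx) :
    mlt ((action φ).actDIV g d) x = mlt d ((shiftIdx (Multiplicative.toAdd (φ g))).symm x) :=
  toAdd_shiftDIV _ d x

variable (S : Action (Type 0) Γ)

/-- An element of `Φ₀(S)` has non-negative multiplicities. [cite: MochizukiEtTh2009, Def 3.1 p.70] -/
theorem mlt_nonneg (ψ : (action φ).phiZero S) (s : S.V) (x : Idx) : 0 ≤ mlt (ψ.1 s) x := (ψ.2.1 s).2 x

/-- Equivariance of an element of `Φ₀(S)`, read on multiplicities. [cite: MochizukiEtTh2009, Def 3.3 p.73] -/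
theorem mlt_ρ (ψ : (action φ).phiZero S) (g : Γ) (s : S.V) (x : Idx) :
    mlt (ψ.1 (S.ρ g s)) x = mlt (ψ.1 s) ((shiftIdx (Multiplicative.toAdd (φ g))).symm x) := by
  rw [ψ.2.2 g s, mlt_actDIV]

/-- Two elements of `Φ₀(S)` with the same multiplicities everywhere are equal. [cite: MochizukiEtTh2009, Def 3.1 p.70] -/
theorem phiZero_ext {ψ ψ' : (action φ).phiZero S} (h : ∀ (s : S.V) (x : Idx), mlt (ψ.1 s) x = mlt (ψ'.1 s) x) : ψ = ψ' :=
  Subtype.ext (funext fun s => ext_mlt fun x => h s x)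

/-! ## Coordinates (Def. 3.1 (i): `DIV⁺ ≅ ∏_{cusps ⊔ components} ℤ_{≥0}`) -/

/-- **The coordinate `(s, x)`**: the multiplicity of `ψ(s)` at the prime log-divisor `x` (a cusp or a component), a monoid
homomorphism `Φ₀(S) → ℤ_{≥0}`. [cite: MochizukiEtTh2009, Def 3.1 p.70] -/
def coord (s : S.V) (x : Idx) : (action φ).phiZero S →* Multiplicative ℕ where
  toFun ψ := Multiplicative.ofAdd (mlt (ψ.1 s) x).toNat
  map_one' := by rw [OneMemClass.coe_one, Pi.one_apply, mlt_one, Int.toNat_zero, ofAdd_zero]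
  map_mul' ψ ψ' := by
    rw [Submonoid.coe_mul, Pi.mul_apply, mlt_mul, Int.toNat_add (mlt_nonneg φ S ψ s x) (mlt_nonneg φ S ψ' s x), ofAdd_add]

/-- The coordinate as an integer is the multiplicity. [cite: MochizukiEtTh2009, Def 3.1 p.70] -/
theorem coord_natCast (s : S.V) (x : Idx) (ψ : (action φ).phiZero S) :
    ((Multiplicative.toAdd (coord φ S s x ψ) : ℕ) : ℤ) = mlt (ψ.1 s) x := by
  change ((mlt (ψ.1 s) x).toNat : ℤ) = _
  exact Int.toNat_of_nonneg (mlt_nonneg φ S ψ s x)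

/-- **The coordinates are jointly injective.** [cite: MochizukiEtTh2009, Def 3.1 p.70] -/
theorem coord_separating {ψ ψ' : (action φ).phiZero S} (h : ∀ (s : S.V) (x : Idx), coord φ S s x ψ = coord φ S s x ψ') :
    ψ = ψ' :=
  phiZero_ext φ S fun s x => by rw [← coord_natCast, ← coord_natCast, h s x]

/-- Coordinates along one orbit determine each other: `coord (g·s) x = coord s ((shift (φ g))⁻¹ x)`.
[cite: MochizukiEtTh2009, Rmk 3.3.1 p.73] -/
theorem coord_ρ (g : Γ) (s : S.V) (x : Idx) (ψ : (action φ).phiZero S) :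
    coord φ S (S.ρ g s) x ψ = coord φ S s ((shiftIdx (Multiplicative.toAdd (φ g))).symm x) ψ := by
  change Multiplicative.ofAdd (mlt _ x).toNat = Multiplicative.ofAdd (mlt _ _).toNat
  rw [mlt_ρ]

/-- Divisibility forces coordinatewise `≤`. [cite: MochizukiEtTh2009, Def 3.1 p.70] -/
theorem toAdd_coord_le_of_dvd {ψ ψ' : (action φ).phiZero S} (h : ψ ∣ ψ') (s : S.V) (x : Idx) :
    Multiplicative.toAdd (coord φ S s x ψ) ≤ Multiplicative.toAdd (coord φ S s x ψ') := by
  obtain ⟨c, rfl⟩ := h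
  rw [map_mul, toAdd_mul]
  exact Nat.le_add_right _ _

/-- **Coordinatewise `≤` gives divisibility** (the quotient is effective and equivariant). [cite: MochizukiEtTh2009, Def 3.3 p.73] -/
theorem dvd_of_toAdd_coord_le {ψ ψ' : (action φ).phiZero S}
    (h : ∀ (s : S.V) (x : Idx), Multiplicative.toAdd (coord φ S s x ψ) ≤ Multiplicative.toAdd (coord φ S s x ψ')) : ψ ∣ ψ' := by
  have h' : ∀ (s : S.V) (x : Idx), mlt (ψ.1 s) x ≤ mlt (ψ'.1 s) x := fun s x => by
    have := Int.ofNat_le.mpr (h s x)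
    rwa [coord_natCast, coord_natCast] at this
  refine ⟨⟨fun s => ψ'.1 s / ψ.1 s, fun s => (mem_Divplus_iff _).2 fun x => ?_, fun g s => ext_mlt fun x => ?_⟩,
    Subtype.ext (funext fun s => ext_mlt fun x => ?_)⟩
  · change 0 ≤ mlt (ψ'.1 s) x - mlt (ψ.1 s) x
    exact sub_nonneg.mpr (h' s x)
  · change mlt (ψ'.1 (S.ρ g s)) x - mlt (ψ.1 (S.ρ g s)) x = mlt ((action φ).actDIV g (ψ'.1 s / ψ.1 s)) x
    rw [mlt_ρ, mlt_ρ, mlt_actDIV]; rfl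
  · change mlt (ψ'.1 s) x = mlt (ψ.1 s) x + (mlt (ψ'.1 s) x - mlt (ψ.1 s) x)
    ring

/-- `ψ ∣ ψ'` iff coordinatewise `≤`. [cite: MochizukiEtTh2009, Def 3.3 p.73] -/
theorem dvd_iff_toAdd_coord_le (ψ ψ' : (action φ).phiZero S) :
    ψ ∣ ψ' ↔ ∀ (s : S.V) (x : Idx), Multiplicative.toAdd (coord φ S s x ψ) ≤ Multiplicative.toAdd (coord φ S s x ψ') :=
  ⟨fun h s x => toAdd_coord_le_of_dvd φ S h s x, dvd_of_toAdd_coord_le φ S⟩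

/-! ## The diagonal (`div ϖ̈ = Σ_j [F_j]`) and the cuspidal element (`div₊ Θ̈ = Σ cusps`) -/

/-- The reduced special fibre `Σ_j [F_j]` (the divisor of the uniformiser `ϖ̈`): `1` on the components, `0` at the cusps.
[cite: MochizukiEtTh2009, Def 3.1 p.70] -/
def ones : model.DIV := Multiplicative.ofAdd (α := Idx → ℤ) fun x => Sum.elim (fun _ => 0) (fun _ => 1) x

/-- Multiplicities of `Σ_j [F_j]`. [cite: MochizukiEtTh2009, Def 3.1 p.70] -/
theorem mlt_ones (x : Idx) : mlt ones x = Sum.elim (fun _ => (0 : ℤ)) (fun _ => 1) x := rfl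

/-- `Σ_j [F_j]` is effective. [cite: MochizukiEtTh2009, Def 3.1 p.70] -/
theorem ones_mem_Divplus : ones ∈ model.Divplus :=
  (mem_Divplus_iff _).2 fun x => by rcases x with c | j <;> simp [mlt_ones]

/-- `Σ_j [F_j]` is translation-invariant. [cite: MochizukiEtTh2009, Def 3.3 p.73] -/
theorem actDIV_ones (g : Γ) : (action φ).actDIV g ones = ones :=
  ext_mlt fun x => by
    rw [mlt_actDIV]
    rcases x with ⟨j, b⟩ | j
    · rw [shiftIdx_symm_inl]; rfl
    · rw [shiftIdx_symm_inr]; rfl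

/-- **The diagonal `diag S ∈ Φ₀(S)`**: the constant family `s ↦ Σ_j [F_j]`. [cite: MochizukiEtTh2009, Def 3.3 p.73] -/
def diag : (action φ).phiZero S := ⟨fun _ => ones, fun _ => ones_mem_Divplus, fun g _ => (actDIV_ones φ g).symm⟩

/-- Coordinates of the diagonal: `1` on the components, `0` at the cusps. [cite: MochizukiEtTh2009, Def 3.1 p.70] -/
theorem coord_diag (s : S.V) (x : Idx) : coord φ S s x (diag φ S) = Multiplicative.ofAdd (Sum.elim (fun _ => 0) (fun _ => 1) x) := by
  rcases x with c | j <;> rfl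

/-- Coordinates of the cuspidal element `thetaZerosPhi` (zero divisor of `Θ̈`): `1` at the cusps, `0` on the components.
[cite: MochizukiEtTh2009, Prop 1.4 p.21] -/
theorem coord_thetaZerosPhi (s : S.V) (x : Idx) :
    coord φ S s x (thetaZerosPhi φ S) = Multiplicative.ofAdd (Sum.elim (fun _ => 1) (fun _ => 0) x) := by
  rcases x with c | j <;> rfl

/-- **The diagonal and the zero divisor of `Θ̈` are independent**: no power of one is a power of the other except trivially —
`Φ₀(S)` has rank `≥ 2` at EVERY nonempty covering (Rmk. 3.3.1; at the chain-only skeletons the one-point covering is rank one).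
[cite: MochizukiEtTh2009, Rmk 3.3.1 p.73] -/
theorem thetaZerosPhi_pow_ne_diag_pow [h : Nonempty S.V] {a : ℕ} (ha : a ≠ 0) (c : ℕ) : thetaZerosPhi φ S ^ a ≠ diag φ S ^ c := by
  obtain ⟨s⟩ := h
  intro e
  have e1 := congrArg (fun ψ => coord φ S s (Sum.inl ((0 : ℤ), false)) ψ) e
  simp only [map_pow, coord_thetaZerosPhi, coord_diag, Sum.elim_inl, ofAdd_zero, one_pow] at e1
  rw [← ofAdd_nsmul, smul_eq_mul, mul_one] at e1
  exact ha (by simpa using e1)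

/-- The diagonal is non-trivial over a nonempty `S`. [cite: MochizukiEtTh2009, Def 3.3 p.73] -/
theorem diag_ne_one [h : Nonempty S.V] : diag φ S ≠ 1 := fun e => by
  obtain ⟨s⟩ := h
  have e1 := congrArg (fun ψ => coord φ S s (Sum.inr (0 : ℤ)) ψ) e
  simp only [coord_diag, Sum.elim_inr, map_one] at e1
  exact one_ne_zero (ofAdd_eq_one.mp e1)

/-! ## The constants `F₀(S)` and their divisors: `Φ₀^cnst(S) = ⟨[diag]⟩` -/

/-- **The constant function with value `u ∈ μ₂ × ⟨ϖ̈⟩` as an element of `B₀(S)`** (equivariant because constants are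
translation-fixed, `actFn_of_mem_const`). [cite: MochizukiEtTh2009, Def 3.3 p.73] -/
def cnstFn (u : model.Fn) (hu : u ∈ model.const) : (action φ).bZero S :=
  ⟨fun _ => u, fun _ => trivial, fun g _ => (actFn_of_mem_const φ g hu).symm⟩

/-- `cnstFn u ∈ F₀(S)`. [cite: MochizukiEtTh2009, Def 3.3 p.73] -/
theorem cnstFn_mem_fZero (u : model.Fn) (hu : u ∈ model.const) : cnstFn φ S u hu ∈ (action φ).fZero S := fun _ => hu

/-- The divisor of a constant `u = (−1)^ε ϖ̈^c` at every point is `c · Σ_j [F_j]`. [cite: MochizukiEtTh2009, Def 3.1 p.70] -/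
theorem mlt_divAt_cnstFn (u : model.Fn) (hu : u ∈ model.const) (s : S.V) (x : Idx) :
    mlt ((action φ).divAt S (cnstFn φ S u hu) s) x = eC (Multiplicative.toAdd u) * mlt ones x := by
  change divFun (Multiplicative.toAdd u) x = _
  rcases x with c | j
  · rw [divFun_inl, hu.2, mlt_ones]; simp
  · rw [divFun_inr, hu.1, hu.2, mlt_ones]; simp

/-- **`div₀` of a constant is a power of the diagonal**: `div₀((−1)^ε ϖ̈^c) = [diag]^c`. [cite: MochizukiEtTh2009, Def 3.3 p.73] -/
theorem divZeroHom_cnstFn (u : model.Fn) (hu : u ∈ model.const) :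
    (action φ).divZeroHom S (cnstFn φ S u hu) = Algebra.GrothendieckGroup.of (diag φ S) ^ eC (Multiplicative.toAdd u) := by
  -- write `c = p - q` with `p, q ≥ 0` and use `div₀ b = [N]/[D] ⟺ div(b s)·D s = N s`
  set c := eC (Multiplicative.toAdd u) with hc
  have h : (action φ).divZeroHom S (cnstFn φ S u hu) =
      Algebra.GrothendieckGroup.of (diag φ S ^ c.toNat) / Algebra.GrothendieckGroup.of (diag φ S ^ (-c).toNat) :=
    ((action φ).divZeroHom_eq_div_iff S _ _ _).2 fun s => ext_mlt fun x => by
      rw [mlt_mul, mlt_divAt_cnstFn]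
      change c * mlt ones x + mlt (ones ^ (-c).toNat) x = mlt (ones ^ c.toNat) x
      rw [mlt_pow, mlt_pow, ← add_mul]
      congr 1
      omega
  rw [h, map_pow, map_pow, div_eq_mul_inv, ← zpow_natCast, ← zpow_natCast, ← zpow_neg, ← zpow_add]
  congr 1
  omega

variable {S}

/-- **On a CONNECTED `S` every element of `F₀(S)` is a constant function** (one orbit; constants translation-fixed).
[cite: MochizukiEtTh2009, Prop 3.4 p.74] -/
theorem exists_eq_cnstFn_of_mem_fZero (hS : isConnectedGSet S) {b : (action φ).bZero S} (hb : b ∈ (action φ).fZero S) :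
    ∃ (u : model.Fn) (hu : u ∈ model.const), b = cnstFn φ S u hu := by
  obtain ⟨⟨s₀⟩, htrans⟩ := (isConnectedGSet_iff S).1 hS
  refine ⟨b.1 s₀, hb s₀, Subtype.ext (funext fun s => ?_)⟩
  obtain ⟨g, rfl⟩ := htrans s₀ s
  rw [b.2.2 g s₀, actFn_of_mem_const φ g (hb s₀)]
  rfl

/-- **`Φ₀^cnst(S)` is the cyclic group of the diagonal** (connected `S`): the cusps never meet the constants' divisors.
[cite: MochizukiEtTh2009, Def 3.3 p.73] -/
theorem divZeroHom_mem_zpowers_of_mem_fZero (hS : isConnectedGSet S) {b : (action φ).bZero S} (hb : b ∈ (action φ).fZero S) :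
    (action φ).divZeroHom S b ∈ Subgroup.zpowers (Algebra.GrothendieckGroup.of (diag φ S)) := by
  obtain ⟨u, hu, rfl⟩ := exists_eq_cnstFn_of_mem_fZero φ hS hb
  rw [divZeroHom_cnstFn]
  exact ⟨_, rfl⟩

/-- Conversely `[diag]` itself is the divisor of the constant `ϖ̈`, on any `S`. [cite: MochizukiEtTh2009, Def 3.3 p.73] -/
theorem divZeroHom_cnstFn_unif : (action φ).divZeroHom S (cnstFn φ S unif ⟨rfl, rfl⟩) = Algebra.GrothendieckGroup.of (diag φ S) := by
  rw [divZeroHom_cnstFn]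
  exact zpow_one _

variable (S)

/-! ## Coprimality through the coordinates (Def. 4.1 (i) «disjoint supports») -/

/-- **The pointwise minimum of two elements of `Φ₀(S)` lies in `Φ₀(S)`** and realises the minimum of the coordinates.
[cite: MochizukiEtTh2009, Def 3.3 p.73] -/
theorem exists_inf (ψ ψ' : (action φ).phiZero S) :
    ∃ μ : (action φ).phiZero S, μ ∣ ψ ∧ μ ∣ ψ' ∧ ∀ (s : S.V) (x : Idx),
      Multiplicative.toAdd (coord φ S s x μ) = min (Multiplicative.toAdd (coord φ S s x ψ)) (Multiplicative.toAdd (coord φ S s x ψ')) := by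
  let m : S.V → model.DIV := fun s => Multiplicative.ofAdd (α := Idx → ℤ) fun x => min (mlt (ψ.1 s) x) (mlt (ψ'.1 s) x)
  have hm : ∀ s x, mlt (m s) x = min (mlt (ψ.1 s) x) (mlt (ψ'.1 s) x) := fun _ _ => rfl
  have hmem : m ∈ (action φ).phiZero S := by
    refine ⟨fun s => (mem_Divplus_iff _).2 fun x => ?_, fun g s => ext_mlt fun x => ?_⟩
    · rw [hm]; exact le_min (mlt_nonneg φ S ψ s x) (mlt_nonneg φ S ψ' s x)
    · rw [hm, mlt_actDIV, hm, mlt_ρ, mlt_ρ]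
  have hc : ∀ (s : S.V) (x : Idx), Multiplicative.toAdd (coord φ S s x ⟨m, hmem⟩) =
      min (Multiplicative.toAdd (coord φ S s x ψ)) (Multiplicative.toAdd (coord φ S s x ψ')) := fun s x => by
    apply Int.ofNat_injective
    change ((Multiplicative.toAdd (coord φ S s x ⟨m, hmem⟩) : ℕ) : ℤ) = ((min _ _ : ℕ) : ℤ)
    rw [Nat.cast_min, coord_natCast, coord_natCast, coord_natCast]
    exact hm s x
  exact ⟨⟨m, hmem⟩, dvd_of_toAdd_coord_le φ S fun s x => by rw [hc]; exact min_le_left _ _,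
    dvd_of_toAdd_coord_le φ S fun s x => by rw [hc]; exact min_le_right _ _, hc⟩

/-- **Coprimality in `Φ₀(S)` is disjointness of the coordinate supports** (cusps AND components).
[cite: MochizukiEtTh2009, Def 4.1 (i) p.86] -/
theorem coprime_iff_coord (ψ ψ' : (action φ).phiZero S) :
    (∀ ξ : (action φ).phiZero S, ξ ∣ ψ → ξ ∣ ψ' → ξ = 1) ↔ ∀ (s : S.V) (x : Idx), coord φ S s x ψ = 1 ∨ coord φ S s x ψ' = 1 := by
  constructor
  · intro h s x
    obtain ⟨μ, hμ, hμ', hc⟩ := exists_inf φ S ψ ψ'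
    have h1 : Multiplicative.toAdd (coord φ S s x μ) = 0 := by rw [h μ hμ hμ', map_one, toAdd_one]
    rw [hc] at h1
    rcases min_eq_iff.mp h1 with ⟨h0, -⟩ | ⟨h0, -⟩
    · exact Or.inl (Multiplicative.toAdd.injective h0)
    · exact Or.inr (Multiplicative.toAdd.injective h0)
  · intro h ξ hξ hξ'
    refine coord_separating φ S fun s x => ?_
    rw [map_one]
    apply Multiplicative.toAdd.injective
    rw [toAdd_one]
    apply Nat.eq_zero_of_le_zero
    rcases h s x with h0 | h0
    · have h1 := toAdd_coord_le_of_dvd φ S hξ s x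
      rwa [h0, toAdd_one] at h1
    · have h1 := toAdd_coord_le_of_dvd φ S hξ' s x
      rwa [h0, toAdd_one] at h1

/-- **The diagonal and the zero divisor of `Θ̈` are COPRIME** (disjoint supports: components vs cusps) — a coprime pair with
content at every covering. [cite: MochizukiEtTh2009, Def 4.1 (i) p.86] -/
theorem coprime_diag_thetaZerosPhi (ξ : (action φ).phiZero S) (h : ξ ∣ diag φ S) (h' : ξ ∣ thetaZerosPhi φ S) : ξ = 1 :=
  (coprime_iff_coord φ S _ _).2 (fun s x => by
    rcases x with c | j
    · exact Or.inl (by rw [coord_diag]; rfl)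
    · exact Or.inr (by rw [coord_thetaZerosPhi]; rfl)) ξ h h'

end TateTowerTheta

end LogDivisorModel

end Literature.AnabelianGeometry.EtaleTheta

end
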